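import Literature.MathematicalPhysics.QuantumFieldTheory.Balaban1983to89.Node00.BgSchemePrOfRecord
import HarnessLib

/-!
# N07 ∕ K0ᴬ — THE TWO [15]-CONTENT KNIT TOKENS (min) `star_isMinOn` AND (c→s) `sol_of_isMinOn` AT THE (47)-CARRYING CHART `S.chartLin T V`,
# DERIVED — generically over a scheme `S : BgScheme F N 𝒴 𝒵 K k`, any slot `T`, any family `Kc` — FROM ONE DISPLAYED PRINT-SHAPED ROW:
# [15] (84) «⟨δA′, J⟩ + ⟨δA′, Δ₁A′⟩ + ⟨δA′, (δ∕δA′)V(A′)⟩» READ ON THE TANGENT DIRECTIONS (83) IN THE (105)–(110) FORM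
# «⟨δ, (Δ₁ + DRD* + aQ*Q)(A₁ + 𝔊J + 𝔊((δ∕δA′)V)(A₁ + H₁B))⟩ = 𝔟(δ, A₁ − T(A₁))», `T` = Prop. 6's map (116)

Cell `pub-ymgap`, seat `pub-ymgap-dag-n07-w3` (g29, WIDTH SEAT 3 on N07 [B11] = [15] = [Balaban1985Variational]); helper file keyed
`--kind proof --supports stmt-QuantumFields-27238 --as helper` (K0ᴬ road); count-neutral.  INTENT-1 of the seat.

## Why

The K0ᴬ road's root theorem ✓`K0AxCtabUniq.rootedReceipts_of_tokens_atScale[_recordScheme_modGauge]` and the P3 door ✓`K0AxCtabUniq.rootFactorAt_of_tokens_chartLin`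
(✓p832458) DISPLAY, for a scheme `S`, a slot `T` and a family `Kc`, five KNIT tokens of [15] Thm 1's content: (rng), (cov), (c→s) `sol_of_isMinOn`, (star_mem), (min)
`star_isMinOn`.  g28 of this seat made (rng) a theorem and supplied (star_mem) at the record (✓p832418 ∕ ✓p833351); (c→s) and (min) — «a chart minimiser IS the fixed
point `𝒜(V)` of (116) in the ball (115)» and «`𝒜(V)` minimises the action on the chart» ([15] Props. 5–7, (82)–(111), (141)–(142)) — were displayed by every consumer
and supplied by no file (census 2026-08-31: 20 files display them, 0 prove them).  This file PROVES BOTH, in the door's literal shape, from: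
* Prop. 6's regime at `V` (`S.RegimeTok`: lit ✓`B11Eq174Chart.Regime` — PROVED consequences used: Banach's fixed point in the ball ✓`Regime.solA_mem` and the (119)–(120)
  Lipschitz bound ✓`B11Prop6Scheme.lipschitz_120` of `T` on a SMALL ball, constant `4B₀C₄(ε′ + a)`),
* (star_mem) and the convexity of `Kc V` (print's chart (75)–(77) is an affine space ∩ sup-norm balls),
* and ONE displayed row, `row84`: for `A ∈ Kc V` and a tangent direction `δ` ((83): the differences of `Kc V` lie in `Dir V`),
  `HasDerivAt (t ↦ A^η(S.chartLin T V (A + t•δ))) (𝔟 V δ (A − T A)) 0` — print's (84) `⟨δ, J⟩ + ⟨δ, Δ₁A′⟩ + ⟨δ, W(A′)⟩` for `δ` in the tangent space (83), rewritten by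
  (100) `⟨δ, Δ₁H₁B⟩ = 0`, (105)–(110) `Δ₁ = Δ_{1,a} − DRD* − aQ*Q` on (83) and `Δ_{1,a}𝔊 = 𝔓*` as `⟨δ, Δ_{1,a}(A₁ + 𝔊J + 𝔊W(A′))⟩ = 𝔟(δ, A₁ − T A₁)` with the ENERGY FORM
  `𝔟(δ, y) := ⟨δ, Δ_{1,a}(U₀) y⟩` (real-linear in `y` — only that is used; rows `|𝔟 δ y| ≤ M‖δ‖‖y‖` and `γ‖δ‖² ≤ 𝔟 δ δ` on `Dir V` — at the record the second IS the road's own `hposπ`,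
  [5] Thm 3.12, uniform on the finite lattice),
* the in-the-small numerics `Kc V ⊆ closedBall 0 ε′`, `2(ε′ + a) ≤ a₃`, `4·M·B₀·C₄·(ε′ + a) < γ` (per-lattice, existential radius downstream — like g27∕g28's rows).

## The argument (one-variable calculus; no convexity lemma of the unprinted kind — cf. lit `B11GlobalMin`, cell D-B11-2)

For `A, A₂ ∈ Kc V`, `δ := A₂ − A`, `g(t) := A^η(S.chartLin T V (A + tδ))`: by `row84` at the points `A + tδ ∈ Kc V` (`t ∈ [0,1]`, convexity) `g′(t) = φ(t) := 𝔟(δ, A_t − T A_t)`,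
and `φ(t) − φ(0) = t·𝔟(δ, δ) − 𝔟(δ, T A_t − T A) ≥ t(γ − 4MB₀C₄(ε′ + a))‖δ‖²` ((120) on the ball `‖·‖ ≤ ε′`).  At `A = 𝒜(V)`: `φ(0) = 𝔟(δ, 𝒜 − T𝒜) = 0` (the fixed point),
so `g′ > 0` on `(0, 1)` when `δ ≠ 0`, hence `g(0) < g(1)` (Mathlib `strictMonoOn_of_deriv_pos`): `𝒜(V)` is the UNIQUE minimiser of `A^η ∘ S.chartLin T V` on `Kc V` —
which is (min), and (c→s) follows because a minimiser equals `𝒜(V)`, which lies in the ball (115) and is fixed by `T`.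

## Contents

* §1 `hasDerivAt_of_shift_zero` (shift bookkeeping), ★ `lt_of_hasDerivAt_pos` (`g 0 < g 1` from a derivative positive on `(0,1)`).
* §2 ★★ `deriv_row_lower_bound` — the increment estimate `φ(t) − φ(0) ≥ t(γ − 4MB₀C₄(ε′+a))‖δ‖²` from (120) and the two `𝔟`-rows;
  ★★★ `wilsonAction4_chartLin_sol_lt` — STRICT MINIMALITY: `A^η(S.chartLin T V (𝒜 V)) < A^η(S.chartLin T V A₂)` for `A₂ ∈ Kc V`, `A₂ ≠ 𝒜(V)`;
  ★★★ `star_isMinOn_of_row84` — (min) in the door's shape; ★★★ `sol_of_isMinOn_of_row84` — (c→s) in the door's shape; ★★★ `minTokens_of_row84` — both, as one conjunction.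

## Honest labels

By-name knit + one-variable calculus over DISPLAYED rows.  The row `row84` = [15] (78)–(81)∕(84) (Sect. C's expansion of the action through (47)) + (100), (105)–(110) (Sect. D's
linear algebra of `𝔊 = G₁𝔓*`, `H₁`) AT THE SCHEME's letters is NOT proved here — it is the N07 expansion programme's deliverable (n07-w1 ✓`N07SectBExpansionAtObjects` (26) at
objects, lit ✓`B11Eq80Current.pair27_W80` (63), ✓`B11Prop5Model.critical82_iff_eq111` over model letters); the `𝔟`-rows are [5] Thm 3.12 (`hposπ`) and finite-dimensional
boundedness; `RegimeTok` is Prop. 6's (117)–(121) with [5] Thm 3.13 and Prop. 4 inside.  LOCATED-g29-1 (seat bus 2026-08-31): `row84` is dischargeable only for families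
inside the LANDAU slice (76) `RD*A′ = 0` — along residual gauge directions the action is constant, so for g28's explicit family `Kc♭_ρ` (no Landau row) (min) ∧ (c→s) is
jointly unsatisfiable; the record instance (next file) adds the row.  Nothing of Bałaban's estimates is proved; K0ᴬ ⟨27238⟩ NOT closed; N07 NOT discharged; COUNT∕K
UNMOVED; R4 is the conditional finite-𝕋⁴ rung `BalabanLadder.UV` only; finite torus at fixed `ε` — nothing continuum ∕ OS ∕ Clay.  **The Yang–Mills mass gap is NOT
proved by any of this.**  No `sorry`, no `def`, no `instance ∕ notation ∕ set_option`; standard axioms.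
[cite: Balaban1985Variational, Prop. 5 p.294, Prop. 6 (115)–(121) p.295, Prop. 7 p.299, (82)–(84) p.290, (100)–(111) pp.293–294, (141)–(142) p.299, (74)–(77) p.289]
-/

noncomputable section

open Set Metric Filter Topology

namespace Summit.QuantumFields.YangMills.Theorems.N07MinTokensOfCriticalRow

open Literature.MathematicalPhysics.QuantumFieldTheory.Balaban1983to89
open Literature.MathematicalPhysics.QuantumFieldTheory.Balaban1983to89.T4Continuum (T4Family)
open Literature.MathematicalPhysics.QuantumFieldTheory.Balaban1983to89.Node00
open B11Eq174Chart (Regime)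
open B11Prop6Scheme (mapT lipschitz_120)

/-! ## §1  One-variable bookkeeping -/

/-- Shift bookkeeping: a derivative of `s ↦ g (t + s)` at `0` is a derivative of `g` at `t`. [folklore] -/
theorem hasDerivAt_of_shift_zero {g : ℝ → ℝ} {t c : ℝ} (h : HasDerivAt (fun s : ℝ => g (t + s)) c 0) : HasDerivAt g c t := by
  have h' : HasDerivAt (fun s : ℝ => g (t + s)) c (t - t) := by rwa [sub_self]
  have := h'.comp_sub_const t t
  simpa only [add_sub_cancel] using this

/-- ★ From a derivative on `[0,1]` that is positive on `(0,1)`: `g 0 < g 1` (Mathlib `strictMonoOn_of_deriv_pos`). [folklore] -/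
theorem lt_of_hasDerivAt_pos {g φ : ℝ → ℝ} (hg : ∀ t ∈ Icc (0 : ℝ) 1, HasDerivAt g (φ t) t) (hpos : ∀ t ∈ Ioo (0 : ℝ) 1, 0 < φ t) :
    g 0 < g 1 := by
  have hcont : ContinuousOn g (Icc (0 : ℝ) 1) := fun t ht => (hg t ht).continuousAt.continuousWithinAt
  have hderiv : ∀ t ∈ interior (Icc (0 : ℝ) 1), 0 < deriv g t := by
    intro t ht
    rw [interior_Icc] at ht
    rw [(hg t (Ioo_subset_Icc_self ht)).deriv]
    exact hpos t ht
  exact strictMonoOn_of_deriv_pos (convex_Icc 0 1) hcont hderiv (left_mem_Icc.2 zero_le_one) (right_mem_Icc.2 zero_le_one) zero_lt_one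

/-! ## §2  The knit over a scheme `S`, a slot `T`, a family `Kc`, an energy form `𝔟` -/

section Scheme

variable {F : T4Family} {N : ℕ} [NeZero N] {𝒴 𝒵 : Type} [NormedAddCommGroup 𝒴] [NormedSpace ℂ 𝒴] [NormedAddCommGroup 𝒵] [NormedSpace ℂ 𝒵] {K k : ℕ}
  (S : BgScheme F N 𝒴 𝒵 K k) (T : GaugeField (F.P K) k (SU N) → 𝒴 → 𝒴)
  (Kc Dir : GaugeField (F.P K) k (SU N) → Set 𝒴) (𝔟 : GaugeField (F.P K) k (SU N) → 𝒴 → 𝒴 →ₗ[ℝ] ℝ)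

omit [NeZero N] in
/-- ★★ **THE INCREMENT ESTIMATE FOR THE DERIVATIVE ROW**: along the segment `A_t = A + tδ` inside the ball `‖·‖ ≤ ε′`, under Prop. 6's regime at `V`,
`φ(t) := 𝔟(δ, A_t − T A_t)` satisfies `φ(t) − φ(0) ≥ t·(γ − 4MB₀C₄(ε′ + a))·‖δ‖²` for `0 ≤ t` — from `𝔟(δ, δ) ≥ γ‖δ‖²`, `|𝔟(δ, y)| ≤ M‖δ‖‖y‖` and the (119)–(120)
Lipschitz bound `‖T A_t − T A‖ ≤ 4B₀C₄(ε′ + a)‖A_t − A‖` of lit ✓`lipschitz_120`. [cite: Balaban1985Variational, (119)–(120) p.295, (110) p.294] -/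
theorem deriv_row_lower_bound {M γ ε' : ℝ} (hM0 : 0 ≤ M) {V : GaugeField (F.P K) k (SU N)}
    (R : Regime (S.𝒢 V) 0 (S.W V) S.B₀ 0 S.C₄ S.a₃ S.j S.a S.ε₄) (h𝔄 : ‖S.𝔄 V‖ < S.a) (hdom : 2 * (ε' + S.a) ≤ S.a₃)
    (hM : ∀ δ y, |𝔟 V δ y| ≤ M * ‖δ‖ * ‖y‖) {δ : 𝒴} (hγ : γ * ‖δ‖ ^ 2 ≤ 𝔟 V δ δ)
    {A : 𝒴} {t : ℝ} (ht : 0 ≤ t) (hA : ‖A‖ ≤ ε') (hAt : ‖A + t • δ‖ ≤ ε') :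
    t * (γ - 4 * M * S.B₀ * S.C₄ * (ε' + S.a)) * ‖δ‖ ^ 2 ≤
      𝔟 V δ (A + t • δ - mapT (S.𝒢 V) 0 (S.W V) (S.J V) (S.𝔄 V) (A + t • δ)) -
        𝔟 V δ (A - mapT (S.𝒢 V) 0 (S.W V) (S.J V) (S.𝔄 V) A) := by
  have hε' : 0 ≤ ε' := (norm_nonneg _).trans hA
  -- (120) on the ball of radius ε'
  have hlip := lipschitz_120 (J := S.J V) R.norm_G R.norm_L R.quad R.B₀_nonneg R.C₄_nonneg h𝔄 hε' hdom hAt hA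
  rw [zero_add, add_sub_cancel_left, norm_smul, Real.norm_eq_abs, abs_of_nonneg ht] at hlip
  -- rewrite the difference of the row values
  have hsplit : 𝔟 V δ (A + t • δ - mapT (S.𝒢 V) 0 (S.W V) (S.J V) (S.𝔄 V) (A + t • δ)) -
      𝔟 V δ (A - mapT (S.𝒢 V) 0 (S.W V) (S.J V) (S.𝔄 V) A) =
      t * 𝔟 V δ δ - 𝔟 V δ (mapT (S.𝒢 V) 0 (S.W V) (S.J V) (S.𝔄 V) (A + t • δ) - mapT (S.𝒢 V) 0 (S.W V) (S.J V) (S.𝔄 V) A) := by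
    have hvec : A + t • δ - mapT (S.𝒢 V) 0 (S.W V) (S.J V) (S.𝔄 V) (A + t • δ) - (A - mapT (S.𝒢 V) 0 (S.W V) (S.J V) (S.𝔄 V) A) =
        t • δ - (mapT (S.𝒢 V) 0 (S.W V) (S.J V) (S.𝔄 V) (A + t • δ) - mapT (S.𝒢 V) 0 (S.W V) (S.J V) (S.𝔄 V) A) := by abel
    rw [← map_sub (𝔟 V δ), hvec, map_sub, LinearMap.map_smul_of_tower, smul_eq_mul]
  rw [hsplit]
  have hb := hM δ (mapT (S.𝒢 V) 0 (S.W V) (S.J V) (S.𝔄 V) (A + t • δ) - mapT (S.𝒢 V) 0 (S.W V) (S.J V) (S.𝔄 V) A)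
  have hb' := (le_abs_self _).trans hb
  have hMδ : 0 ≤ M * ‖δ‖ := mul_nonneg hM0 (norm_nonneg _)
  have hchain : M * ‖δ‖ * ‖mapT (S.𝒢 V) 0 (S.W V) (S.J V) (S.𝔄 V) (A + t • δ) - mapT (S.𝒢 V) 0 (S.W V) (S.J V) (S.𝔄 V) A‖ ≤
      M * ‖δ‖ * (4 * S.B₀ * S.C₄ * (ε' + S.a) * (t * ‖δ‖)) := mul_le_mul_of_nonneg_left hlip hMδ
  have hsq : ‖δ‖ ^ 2 = ‖δ‖ * ‖δ‖ := sq ‖δ‖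
  nlinarith [hγ, hb', hchain, hsq, norm_nonneg δ]

variable {S T Kc Dir 𝔟}

/-- ★★★ **STRICT MINIMALITY OF THE FIXED POINT ON THE CHART**: under the displayed rows, `A^η(S.chartLin T V (𝒜 V)) < A^η(S.chartLin T V A₂)` for every `A₂ ∈ Kc V`,
`A₂ ≠ 𝒜(V)` — print's «Hence A′ = 0 is a minimum of the functional» ((142), re-centred at `U_k`) in the small, with uniqueness. [cite: Balaban1985Variational, (141)–(142) p.299, Prop. 6 p.295, (84) p.290, (110) p.294] -/
theorem wilsonAction4_chartLin_sol_lt [CompleteSpace 𝒴] {M γ ε' : ℝ} (hM0 : 0 ≤ M) (hR : S.RegimeTok)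
    (star_mem : ∀ V ∈ S.dom, S.sol V ∈ Kc V) (hconv : ∀ V ∈ S.dom, Convex ℝ (Kc V))
    (hdir : ∀ V ∈ S.dom, ∀ A ∈ Kc V, ∀ A₂ ∈ Kc V, A₂ - A ∈ Dir V)
    (row84 : ∀ V ∈ S.dom, ∀ A ∈ Kc V, ∀ δ ∈ Dir V,
      HasDerivAt (fun t : ℝ => wilsonAction4 (S.chartLin T V (A + t • δ))) (𝔟 V δ (A - mapT (S.𝒢 V) 0 (S.W V) (S.J V) (S.𝔄 V) A)) 0)
    (hM : ∀ V ∈ S.dom, ∀ δ y, |𝔟 V δ y| ≤ M * ‖δ‖ * ‖y‖) (hγ : ∀ V ∈ S.dom, ∀ δ ∈ Dir V, γ * ‖δ‖ ^ 2 ≤ 𝔟 V δ δ)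
    (hKc : ∀ V ∈ S.dom, ∀ A ∈ Kc V, ‖A‖ ≤ ε') (hdom : 2 * (ε' + S.a) ≤ S.a₃) (hnum : 4 * M * S.B₀ * S.C₄ * (ε' + S.a) < γ)
    {V : GaugeField (F.P K) k (SU N)} (hV : V ∈ S.dom) {A₂ : 𝒴} (hA₂ : A₂ ∈ Kc V) (hne : A₂ ≠ S.sol V) :
    wilsonAction4 (S.chartLin T V (S.sol V)) < wilsonAction4 (S.chartLin T V A₂) := by
  obtain ⟨R, hJ, h𝔄⟩ := hR V hV
  have hsol := R.solA_mem hJ h𝔄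
  -- `S.sol V` is the selected fixed point
  have hfix : mapT (S.𝒢 V) 0 (S.W V) (S.J V) (S.𝔄 V) (S.sol V) = S.sol V := hsol.2
  set A := S.sol V with hAdef
  set δ : 𝒴 := A₂ - A with hδdef
  have hδ : δ ∈ Dir V := hdir V hV A (star_mem V hV) A₂ hA₂
  have hδne : δ ≠ 0 := fun h => hne (sub_eq_zero.1 h)
  -- the points of the segment
  have hseg : ∀ t ∈ Icc (0 : ℝ) 1, A + t • δ ∈ Kc V := fun t ht => (hconv V hV).add_smul_sub_mem (star_mem V hV) hA₂ ht
  -- the derivative row along the segment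
  set g : ℝ → ℝ := fun t => wilsonAction4 (S.chartLin T V (A + t • δ)) with hgdef
  set φ : ℝ → ℝ := fun t => 𝔟 V δ (A + t • δ - mapT (S.𝒢 V) 0 (S.W V) (S.J V) (S.𝔄 V) (A + t • δ)) with hφdef
  have hg : ∀ t ∈ Icc (0 : ℝ) 1, HasDerivAt g (φ t) t := by
    intro t ht
    have h := row84 V hV (A + t • δ) (hseg t ht) δ hδ
    apply hasDerivAt_of_shift_zero
    have heq : (fun s : ℝ => g (t + s)) = fun s : ℝ => wilsonAction4 (S.chartLin T V (A + t • δ + s • δ)) := by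
      funext s; simp only [hgdef, add_smul, add_assoc]
    rw [heq]; exact h
  -- positivity of the derivative on (0,1)
  have hpos : ∀ t ∈ Ioo (0 : ℝ) 1, 0 < φ t := by
    intro t ht
    have hA : ‖A‖ ≤ ε' := hKc V hV A (star_mem V hV)
    have hAt : ‖A + t • δ‖ ≤ ε' := hKc V hV _ (hseg t (Ioo_subset_Icc_self ht))
    have hlow := deriv_row_lower_bound S 𝔟 hM0 R h𝔄 hdom (hM V hV) (hγ V hV δ hδ) ht.1.le hA hAt
    have h0 : 𝔟 V δ (A - mapT (S.𝒢 V) 0 (S.W V) (S.J V) (S.𝔄 V) A) = 0 := by rw [hfix, sub_self, map_zero]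
    rw [h0, sub_zero] at hlow
    have hδpos : 0 < ‖δ‖ ^ 2 := by positivity
    have h1 : 0 < γ - 4 * M * S.B₀ * S.C₄ * (ε' + S.a) := sub_pos.2 hnum
    exact (mul_pos (mul_pos ht.1 h1) hδpos).trans_le hlow
  have hlt := lt_of_hasDerivAt_pos hg hpos
  simpa only [hgdef, zero_smul, add_zero, one_smul, hδdef, add_sub_cancel] using hlt

/-- ★★★ **THE KNIT TOKEN (min) `star_isMinOn` FROM THE ROW (84)+(110)**, in the door's literal shape: `𝒜(V)` minimises `A^η ∘ S.chartLin T V` on `Kc V` for every `V` of the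
domain. [cite: Balaban1985Variational, Prop. 7 p.299, (141)–(142) p.299, (84) p.290, (110) p.294] -/
theorem star_isMinOn_of_row84 [CompleteSpace 𝒴] {M γ ε' : ℝ} (hM0 : 0 ≤ M) (hR : S.RegimeTok)
    (star_mem : ∀ V ∈ S.dom, S.sol V ∈ Kc V) (hconv : ∀ V ∈ S.dom, Convex ℝ (Kc V))
    (hdir : ∀ V ∈ S.dom, ∀ A ∈ Kc V, ∀ A₂ ∈ Kc V, A₂ - A ∈ Dir V)
    (row84 : ∀ V ∈ S.dom, ∀ A ∈ Kc V, ∀ δ ∈ Dir V,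
      HasDerivAt (fun t : ℝ => wilsonAction4 (S.chartLin T V (A + t • δ))) (𝔟 V δ (A - mapT (S.𝒢 V) 0 (S.W V) (S.J V) (S.𝔄 V) A)) 0)
    (hM : ∀ V ∈ S.dom, ∀ δ y, |𝔟 V δ y| ≤ M * ‖δ‖ * ‖y‖) (hγ : ∀ V ∈ S.dom, ∀ δ ∈ Dir V, γ * ‖δ‖ ^ 2 ≤ 𝔟 V δ δ)
    (hKc : ∀ V ∈ S.dom, ∀ A ∈ Kc V, ‖A‖ ≤ ε') (hdom : 2 * (ε' + S.a) ≤ S.a₃) (hnum : 4 * M * S.B₀ * S.C₄ * (ε' + S.a) < γ) :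
    ∀ V ∈ S.dom, IsMinOn (wilsonAction4 ∘ S.chartLin T V) (Kc V) (S.sol V) := by
  intro V hV A₂ hA₂
  show wilsonAction4 (S.chartLin T V (S.sol V)) ≤ wilsonAction4 (S.chartLin T V A₂)
  by_cases hne : A₂ = S.sol V
  · rw [hne]
  · exact (wilsonAction4_chartLin_sol_lt hM0 hR star_mem hconv hdir row84 hM hγ hKc hdom hnum hV hA₂ hne).le

/-- ★★★ **THE KNIT TOKEN (c→s) `sol_of_isMinOn` FROM THE ROW (84)+(110)**, in the door's literal shape: a minimiser of `A^η ∘ S.chartLin T V` on `Kc V` lies in the ball (115)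
and is fixed by Prop. 6's map (116) — because it IS `𝒜(V)`. [cite: Balaban1985Variational, Prop. 5 p.294, Prop. 6 (115)–(116) p.295, (82)–(84) p.290, (110)–(111) p.294] -/
theorem sol_of_isMinOn_of_row84 [CompleteSpace 𝒴] {M γ ε' : ℝ} (hM0 : 0 ≤ M) (hR : S.RegimeTok)
    (star_mem : ∀ V ∈ S.dom, S.sol V ∈ Kc V) (hconv : ∀ V ∈ S.dom, Convex ℝ (Kc V))
    (hdir : ∀ V ∈ S.dom, ∀ A ∈ Kc V, ∀ A₂ ∈ Kc V, A₂ - A ∈ Dir V)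
    (row84 : ∀ V ∈ S.dom, ∀ A ∈ Kc V, ∀ δ ∈ Dir V,
      HasDerivAt (fun t : ℝ => wilsonAction4 (S.chartLin T V (A + t • δ))) (𝔟 V δ (A - mapT (S.𝒢 V) 0 (S.W V) (S.J V) (S.𝔄 V) A)) 0)
    (hM : ∀ V ∈ S.dom, ∀ δ y, |𝔟 V δ y| ≤ M * ‖δ‖ * ‖y‖) (hγ : ∀ V ∈ S.dom, ∀ δ ∈ Dir V, γ * ‖δ‖ ^ 2 ≤ 𝔟 V δ δ)
    (hKc : ∀ V ∈ S.dom, ∀ A ∈ Kc V, ‖A‖ ≤ ε') (hdom : 2 * (ε' + S.a) ≤ S.a₃) (hnum : 4 * M * S.B₀ * S.C₄ * (ε' + S.a) < γ) :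
    ∀ V ∈ S.dom, ∀ A ∈ Kc V, IsMinOn (wilsonAction4 ∘ S.chartLin T V) (Kc V) A →
      ‖A‖ ≤ S.ε₄ ∧ mapT (S.𝒢 V) 0 (S.W V) (S.J V) (S.𝔄 V) A = A := by
  intro V hV A hA hmin
  have hEq : A = S.sol V := by
    by_contra hne
    have hlt := wilsonAction4_chartLin_sol_lt hM0 hR star_mem hconv hdir row84 hM hγ hKc hdom hnum hV hA hne
    have hle : wilsonAction4 (S.chartLin T V A) ≤ wilsonAction4 (S.chartLin T V (S.sol V)) := hmin (star_mem V hV)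
    exact absurd hle (not_le.2 hlt)
  obtain ⟨R, hJ, h𝔄⟩ := hR V hV
  rw [hEq]
  exact R.solA_mem hJ h𝔄

/-- ★★★ **BOTH KNIT TOKENS AT ONCE** — (min) ∧ (c→s) for `S.chartLin T`, the family `Kc`, every `V ∈ S.dom`, from Prop. 6's regime, (star_mem), convexity, the row (84)+(110)
with its energy-form rows, and the in-the-small numerics; feed to ✓`K0AxCtabUniq.rootFactorAt_of_tokens_chartLin` ∕ the road as `star_isMinOn` ∕ `sol_of_isMinOn`.
[cite: Balaban1985Variational, Thm 1 p.279, Prop. 5 p.294, Prop. 6 p.295, Prop. 7 p.299, (84) p.290, (110) p.294] -/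
theorem minTokens_of_row84 [CompleteSpace 𝒴] {M γ ε' : ℝ} (hM0 : 0 ≤ M) (hR : S.RegimeTok)
    (star_mem : ∀ V ∈ S.dom, S.sol V ∈ Kc V) (hconv : ∀ V ∈ S.dom, Convex ℝ (Kc V))
    (hdir : ∀ V ∈ S.dom, ∀ A ∈ Kc V, ∀ A₂ ∈ Kc V, A₂ - A ∈ Dir V)
    (row84 : ∀ V ∈ S.dom, ∀ A ∈ Kc V, ∀ δ ∈ Dir V,
      HasDerivAt (fun t : ℝ => wilsonAction4 (S.chartLin T V (A + t • δ))) (𝔟 V δ (A - mapT (S.𝒢 V) 0 (S.W V) (S.J V) (S.𝔄 V) A)) 0)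
    (hM : ∀ V ∈ S.dom, ∀ δ y, |𝔟 V δ y| ≤ M * ‖δ‖ * ‖y‖) (hγ : ∀ V ∈ S.dom, ∀ δ ∈ Dir V, γ * ‖δ‖ ^ 2 ≤ 𝔟 V δ δ)
    (hKc : ∀ V ∈ S.dom, ∀ A ∈ Kc V, ‖A‖ ≤ ε') (hdom : 2 * (ε' + S.a) ≤ S.a₃) (hnum : 4 * M * S.B₀ * S.C₄ * (ε' + S.a) < γ) :
    (∀ V ∈ S.dom, IsMinOn (wilsonAction4 ∘ S.chartLin T V) (Kc V) (S.sol V)) ∧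
    (∀ V ∈ S.dom, ∀ A ∈ Kc V, IsMinOn (wilsonAction4 ∘ S.chartLin T V) (Kc V) A →
      ‖A‖ ≤ S.ε₄ ∧ mapT (S.𝒢 V) 0 (S.W V) (S.J V) (S.𝔄 V) A = A) :=
  ⟨star_isMinOn_of_row84 hM0 hR star_mem hconv hdir row84 hM hγ hKc hdom hnum,
    sol_of_isMinOn_of_row84 hM0 hR star_mem hconv hdir row84 hM hγ hKc hdom hnum⟩

end Scheme

end Summit.QuantumFields.YangMills.Theorems.N07MinTokensOfCriticalRow

end
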